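import Summits.CriticalPhenomena.PercolationContinuityZ3.Theorems.PercNonProliferationFreeBoxPowerSavingOneArmDictionary
import Summits.CriticalPhenomena.PercolationContinuityZ3.Theorems.PercNonProliferationPolynomialPairGivesSparse
import HarnessLib

/-!
# Crux `PercNonProliferation.FreeBoxSparse` (stmt-CriticalPhenomena-4445) — the PARKING EDGES, name-keyed

Helper file `--supports stmt-CriticalPhenomena-4445` (lead c5). No new mathematics: it composes landed theorems into
single named implications whose conclusion is literally the crux decl
`Summit.CriticalPhenomena.PercolationContinuityZ3.Theses.PercNonProliferation.FreeBoxSparse`, so that the ledger's cone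
parser and future seats see at a glance behind which EXISTING statements the crux is parked
(Cruxes/FreeBoxSparse/STRATEGY-CENSUS.md §5–§6, PICKED.md / LeadC5Note.md of lead c5):

* `freeBoxSparse_of_freeBoxPowerSaving` — r5 ⟹ r3 with the idle hypothesis of `PolynomialPairGivesSparse` removed
  (`FreeBoxPowerSaving → FreeBoxSparse`, the squeeze `0 ≤ FA₂(n) ≤ C n^{-a} → 0`).
* `freeBoxSparse_of_oneArm_decay` — a polynomial one-arm rate at `p_c(ℤ³)` gives the crux
  (`FreeBoxPowerSavingNegative.of_oneArm_decay` + the squeeze).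
* `freeBoxSparse_of_cesaroBlocking` — Cesàro blocking `∃ c > 0, ∀ᶠ K, cK ≤ Σ_{j<K} u_{2^j}(p_c)` gives the crux
  (`OneArmDictionary.freeBoxPowerSaving_of_cesaroBlocking`); this hypothesis is summit-strength
  (`OneArmDictionary.percolationContinuityZ3_of_cesaroBlocking`).
* `freeBoxSparse_of_critAnnulusNonCrossing` — **`X_B ⟹ FreeBoxSparse`**: the crux of route PercAnnulusCrossing
  (`CritAnnulusNonCrossing`, stmt-CriticalPhenomena-0846) implies this crux
  (`OneArmDictionary.freeBoxPowerSaving_of_critAnnulusNonCrossing` + the squeeze). This is the edge behind which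
  lead c5 parks stmt-4445 (`blocked-on: stmt-CriticalPhenomena-0846`).

The fourth landed sufficient edge, `PercolationContinuityZ3 → FreeBoxSparse`, lives in
`Theorems/FreeBoxSparse/Negative/OfContinuity.lean` and is not restated. No definitions; no sorry.
-/

namespace Summit.CriticalPhenomena.PercolationContinuityZ3.Theorems.FreeBoxSparse.Parking

open Literature.Probability.Percolation Literature.Probability.LatticeModels
open Summit.CriticalPhenomena.PercolationContinuityZ3.Theses.PercNonProliferation
open Summit.CriticalPhenomena.PercolationContinuityZ3.FreeBoxPowerSavingLine
open Summit.CriticalPhenomena.PercolationContinuityZ3.FreeBoxPowerSavingNegative (of_oneArm_decay)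
open Summit.CriticalPhenomena.PercolationContinuityZ3.Theorems.SubpolynomialBlocking.Negative (blockProb)
open scoped BigOperators

/-- **r5 ⟹ r3**: a power saving `FA₂(n) ≤ C n^{-a}` (`a > 0`, `n ≥ 1`) for the free-box pair average at `p_c(ℤ³)`
forces `FA₂(n) → 0`, i.e. `FreeBoxPowerSaving → FreeBoxSparse` — `PolynomialPairGivesSparse` with its idle hypothesis
`SubpolynomialBlocking` dropped (same squeeze, `polynomialPairGivesSparse_squeeze`). [folklore] -/
theorem freeBoxSparse_of_freeBoxPowerSaving :
    Summit.CriticalPhenomena.PercolationContinuityZ3.Theses.PercNonProliferation.FreeBoxPowerSaving →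
      Summit.CriticalPhenomena.PercolationContinuityZ3.Theses.PercNonProliferation.FreeBoxSparse := by
  intro h5
  unfold FreeBoxPowerSaving at h5
  unfold FreeBoxSparse
  obtain ⟨a, C, ha, hC⟩ := h5
  refine polynomialPairGivesSparse_squeeze (fun n => ?_) ha hC
  exact div_nonneg (Finset.sum_nonneg fun x _ => Finset.sum_nonneg fun y _ =>
    MeasureTheory.measureReal_nonneg) (sq_nonneg _)

/-- **A polynomial one-arm rate at `p_c(ℤ³)` gives the crux**: if `π_{p_c}(m) ≤ C m^{-s}` for all `m ≥ 1` with `s > 0`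
(`π = oneArmProb 3 (criticalProbI 3)`), then `FreeBoxSparse` (one-arm decay ⟹ power saving, landed as
`FreeBoxPowerSavingNegative.of_oneArm_decay`, then the squeeze). [folklore] -/
theorem freeBoxSparse_of_oneArm_decay {s C : ℝ} (hs : 0 < s)
    (hC : ∀ m : ℕ, 1 ≤ m → oneArmProb 3 (criticalProbI 3) m ≤ C * (m : ℝ) ^ (-s)) : FreeBoxSparse :=
  freeBoxSparse_of_freeBoxPowerSaving (of_oneArm_decay hs hC)

/-- **Cesàro blocking at `p_c(ℤ³)` gives the crux**: `∃ c > 0, ∀ᶠ K, c·K ≤ Σ_{j<K} u_{2^j}(p_c)` with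
`u_m = blockProb 3 (criticalProbI 3) m = P_{p_c}(B(m) ↮ ∂ⁱⁿB(2m) inside B(2m))` implies `FreeBoxSparse`
(`OneArmDictionary.freeBoxPowerSaving_of_cesaroBlocking` + the squeeze). The hypothesis is summit-strength
(`OneArmDictionary.percolationContinuityZ3_of_cesaroBlocking`), recorded here only as a parking edge. [folklore] -/
theorem freeBoxSparse_of_cesaroBlocking
    (h : ∃ c : ℝ, 0 < c ∧ ∀ᶠ K : ℕ in Filter.atTop, c * (K : ℝ) ≤
      ∑ j ∈ Finset.range K, blockProb 3 (criticalProbI 3) (2 ^ j)) : FreeBoxSparse :=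
  freeBoxSparse_of_freeBoxPowerSaving (OneArmDictionary.freeBoxPowerSaving_of_cesaroBlocking h)

/-- **`X_B ⟹ FreeBoxSparse`** (stmt-CriticalPhenomena-0846 ⟹ stmt-CriticalPhenomena-4445): the critical
annulus-blocking floor `P_{p_c}(B(n) ↔ ∂ⁱⁿB(2n) inside B(2n)) ≤ 1 - c` (`n ≥ 1`) of route PercAnnulusCrossing implies the
free-box sparsity crux of route PercNonProliferation, through the landed chain
`X_B ⟹ Cesàro blocking ⟹ one-arm rate ⟹ FreeBoxPowerSaving ⟹ FreeBoxSparse`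
(`OneArmDictionary.freeBoxPowerSaving_of_critAnnulusNonCrossing`, then the squeeze). This is the edge behind which the
crux is parked by lead c5 (`blocked-on: stmt-CriticalPhenomena-0846`). [folklore] -/
theorem freeBoxSparse_of_critAnnulusNonCrossing :
    Summit.CriticalPhenomena.PercolationContinuityZ3.Theses.PercAnnulusCrossing.CritAnnulusNonCrossing →
      Summit.CriticalPhenomena.PercolationContinuityZ3.Theses.PercNonProliferation.FreeBoxSparse :=
  fun hXB => freeBoxSparse_of_freeBoxPowerSaving (OneArmDictionary.freeBoxPowerSaving_of_critAnnulusNonCrossing hXB)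

end Summit.CriticalPhenomena.PercolationContinuityZ3.Theorems.FreeBoxSparse.Parking
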